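import Summits.ABC.StewartYu.KappaDoorEpsShape
import Summits.ABC.StewartYu.PrimePadicSocketOdd
import Summits.ABC.StewartYu.PadicLogFormsPrincipalReduction
import HarnessLib

/-!
# Cell abc-stewartyu: the abc rungs from a Theorem-A-shaped bound ALONE (WP-M consumed)

`Summits/ABC/StewartYu/AbcOfPrincipalCore.lean` — cell `abc-stewartyu` (seat p3; theorems only).
With WP-M in the tree (`Summit.ABC.StewartYu.PrincipalLattice.exists_principal_generators`,
`PadicLogFormsPrincipalReduction.lean`), the glue (`primePadicBoundAt_odd_of_principal`), the
odd-prime socket (`stewartTijdeman1986_of_oddPrime_logRadShape`) and the κ-door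
(`KappaDoor.epsShapeBoundThree_of_principal_core`), every Yu-type bound for `p`-adic linear forms in
logarithms of principal units with envelope `C(m) ≤ c₁^m m^{c₂ m}` yields:

* `stewartTijdeman1986_of_principalCore` — `c₂ ≤ 10` ⟹ `stewartTijdeman1986_upperBound`
  (`log c ≤ κ·rad(abc)^15`, rung M1);
* `epsShapeBoundThree_of_principalCore` — `c₂ ≤ 1` ⟹ `EpsShapeBoundThree`
  (`log c ≪_ε rad(abc)^{3+ε}`, rung M1⁺(3)); `epsShapeBoundFour_of_principalCore` — `c₂ ≤ 2` ⟹
  `EpsShapeBoundFour`.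

So the rungs rest on exactly ONE statement, the bound itself (route items `TheoremA` /
`TheoremAOne`), proved in staging (`PadicCW77TheoremA.lean`). Everything is [folklore] assembly.
-/

noncomputable section

open Finset
open Literature.Barriers.ABC

namespace Summit.ABC.StewartYu

/-- **Rung M1 from the bound alone**: a Theorem-A-shaped bound with `1 ≤ c₁`, `0 ≤ c₂ ≤ 10` gives
`stewartTijdeman1986_upperBound`. [folklore] -/
theorem stewartTijdeman1986_of_principalCore {C : ℕ → ℝ} {r : ℕ → ℕ} {c₁ c₂ : ℝ} (hc₁ : 1 ≤ c₁)
    (hc₂ : 0 ≤ c₂) (hc₂' : c₂ ≤ 10) (hC : ∀ m, 0 ≤ C m ∧ C m ≤ c₁ ^ m * (m : ℝ) ^ (c₂ * m))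
    (hA : ∀ (p : ℕ), p.Prime → p ≠ 2 →
      ∀ (m : ℕ) (α : Fin m → ℚ) (b : Fin m → ℤ) (V : Fin m → ℝ) (Vmax W : ℝ),
        (∀ j, α j ≠ 0 ∧ 1 ≤ padicValRat p (α j - 1)) →
        (∀ μ : Fin m → ℤ, ∏ j, α j ^ μ j = 1 → μ = 0) →
        (∀ T : Finset (Fin m), T.Nonempty → ¬ IsSquare (∏ j ∈ T, α j)) →
        (∀ j, Height.logHeight₁ (α j) ≤ V j) → (∀ j, Real.log p ≤ V j) → (∀ j, V j ≤ Vmax) →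
        b ≠ 0 → (∀ j, Real.log (max 3 (|b j| : ℝ)) ≤ W) →
        (padicValRat p (∏ j, α j ^ b j - 1) : ℝ) * Real.log p ≤
          C m * (∏ j, V j) * (W + Real.log (2 * Vmax)) * Real.log (2 * Vmax) / Real.log p ^ r m) :
    stewartTijdeman1986_upperBound := by
  refine stewartTijdeman1986_of_oddPrime_logRadShape (K := 4704) (L := 32 * c₁) (κ := c₂ + 2) (σ := 2)
    (τ := 2) (τ₁ := 2) (by norm_num) (by linarith) (by linarith) (by norm_num) (by linarith) ?_
  intro p hp hp2 n q e hq hinj hqp he hne1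
  exact primePadicBoundAt_odd_of_principal PrincipalLattice.exists_principal_generators hc₁ hC hA
    hp hp2 n q e hq hinj hqp he hne1

/-- **Rung M1⁺(3) from the bound alone**: `c₂ ≤ 1` gives `EpsShapeBoundThree`
(`log c ≪_ε rad(abc)^{3+ε}`). [folklore] -/
theorem epsShapeBoundThree_of_principalCore {C : ℕ → ℝ} {r : ℕ → ℕ} {c₁ c₂ : ℝ} (hc₁ : 1 ≤ c₁)
    (hc₂' : c₂ ≤ 1) (hC : ∀ m, 0 ≤ C m ∧ C m ≤ c₁ ^ m * (m : ℝ) ^ (c₂ * m))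
    (hA : ∀ (p : ℕ), p.Prime → p ≠ 2 →
      ∀ (m : ℕ) (α : Fin m → ℚ) (b : Fin m → ℤ) (V : Fin m → ℝ) (Vmax W : ℝ),
        (∀ j, α j ≠ 0 ∧ 1 ≤ padicValRat p (α j - 1)) →
        (∀ μ : Fin m → ℤ, ∏ j, α j ^ μ j = 1 → μ = 0) →
        (∀ T : Finset (Fin m), T.Nonempty → ¬ IsSquare (∏ j ∈ T, α j)) →
        (∀ j, Height.logHeight₁ (α j) ≤ V j) → (∀ j, Real.log p ≤ V j) → (∀ j, V j ≤ Vmax) →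
        b ≠ 0 → (∀ j, Real.log (max 3 (|b j| : ℝ)) ≤ W) →
        (padicValRat p (∏ j, α j ^ b j - 1) : ℝ) * Real.log p ≤
          C m * (∏ j, V j) * (W + Real.log (2 * Vmax)) * Real.log (2 * Vmax) / Real.log p ^ r m) :
    EpsShapeBoundThree :=
  KappaDoor.epsShapeBoundThree_of_principal_core PrincipalLattice.exists_principal_generators hc₁ hc₂' hC hA

/-- **Rung M1⁺(4) from the bound alone**: `c₂ ≤ 2` gives `EpsShapeBoundFour`. [folklore] -/
theorem epsShapeBoundFour_of_principalCore {C : ℕ → ℝ} {r : ℕ → ℕ} {c₁ c₂ : ℝ} (hc₁ : 1 ≤ c₁)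
    (hc₂' : c₂ ≤ 2) (hC : ∀ m, 0 ≤ C m ∧ C m ≤ c₁ ^ m * (m : ℝ) ^ (c₂ * m))
    (hA : ∀ (p : ℕ), p.Prime → p ≠ 2 →
      ∀ (m : ℕ) (α : Fin m → ℚ) (b : Fin m → ℤ) (V : Fin m → ℝ) (Vmax W : ℝ),
        (∀ j, α j ≠ 0 ∧ 1 ≤ padicValRat p (α j - 1)) →
        (∀ μ : Fin m → ℤ, ∏ j, α j ^ μ j = 1 → μ = 0) →
        (∀ T : Finset (Fin m), T.Nonempty → ¬ IsSquare (∏ j ∈ T, α j)) →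
        (∀ j, Height.logHeight₁ (α j) ≤ V j) → (∀ j, Real.log p ≤ V j) → (∀ j, V j ≤ Vmax) →
        b ≠ 0 → (∀ j, Real.log (max 3 (|b j| : ℝ)) ≤ W) →
        (padicValRat p (∏ j, α j ^ b j - 1) : ℝ) * Real.log p ≤
          C m * (∏ j, V j) * (W + Real.log (2 * Vmax)) * Real.log (2 * Vmax) / Real.log p ^ r m) :
    EpsShapeBoundFour :=
  KappaDoor.epsShapeBoundFour_of_principal_core PrincipalLattice.exists_principal_generators hc₁ hc₂' hC hA

end Summit.ABC.StewartYu

end
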